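import Mathlib
import HarnessLib
import Summits.Ventures.LatticeQCDFlow.Exactness.SU2ResidualLayer
import Summits.Ventures.LatticeQCDFlow.Exactness.GaugeFTHMCCreutz

/-!
# The engine's learned `SU(2)` residual layer: detailed balance and `⟨e^{−ΔH̃}⟩ = 1`

HONEST FRAMING: exact (Metropolis-corrected) sampling algorithms for lattice gauge theory;
figures of merit are autocorrelation/cost numbers at stated couplings and volumes; no
continuum-physics claim.

Venture `LatticeQCDFlow` (cell pub-lqcd), topic `Exactness`; FANOUT row 14 (`eng-flowhmc`, engine
`latflow.fthmc`, family B; members `maps.residual_trained_scan` / `residual_scan_apply`: a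
`lax.scan` over layer specs `(μ, phase, stacked per-layer CNN weights)`, each layer the weighted
staple kick of `SU2ResidualLayer.lean`, the log-det accumulated along the scan).  NEW WORK of the
cell; nothing is cited as a fact; no number.  Sequel of `SU2ResidualLayer.lean` (one learned
layer: certified, measurable equivalence, FT-HMC exact):

* **`su2_fthmc_leapfrog_gaussian_isReversible_residualLayer`** — FT-HMC as the engine runs it on
  the `SU(2)` rung through one learned layer satisfies detailed balance w.r.t. `e^{−S}·⊗Haar`
  (the standing hypothesis of the cell's reversible-chain `τ_int` theorems);
* **`su2_fthmc_leapfrog_gaussian_creutz_residualLayer`** — started in equilibrium it has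
  `⟨e^{−ΔH̃}⟩ = 1` exactly (`e^{−S}` integrable, e.g. any action bounded below) — the quantity
  row 14's acceptance gate estimates, now for the LEARNED member's layers too.

Whole learned members (schedules of residual layers with the running log-det) are in
`SU2ResidualMember.lean`.

A proper two-class colouring exists on every even torus (`WilsonFlowMasks.exists_parityMask`), in
particular on the row's 4⁴ acceptance lattice, so none of this is vacuous there.

NOT CLAIMED: anything about the network beyond (measurable, reads frozen links, squashed);
`SU(N ≥ 3)`; ergodicity; burn-in / error model; any number.
-/

noncomputable section

namespace Summit.Ventures.LatticeQCDFlow.Exactness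

open Real Set MeasureTheory Measure InnerProductGeometry Metric WithLp
open Literature.MathematicalPhysics.QuantumFieldTheory Summit.Ventures.LatticeQCDFlow.Theory2
open ProbabilityTheory ProbabilityTheory.Kernel
open Literature.Probability.MarkovChains.HMC (boltzmann)
open scoped ENNReal Matrix

variable {d L : ℕ} {X : Type*} [DecidableEq X] (χ : Site d L → X) [NeZero L]

/-! ## One learned layer: detailed balance and `⟨e^{−ΔH̃}⟩ = 1` -/

section Layer

/-- **… and satisfies detailed balance** with respect to `e^{−S} · ⊗_e haarProbability SU(2)`. -/
theorem su2_fthmc_leapfrog_gaussian_isReversible_residualLayer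
    (hχ : ∀ (x : Site d L) (i : Fin d), χ (x.shift i) ≠ χ x) (μ : Fin d) (b : X) {c : ℝ}
    (ρ : GaugeConfig d L (Matrix.specialUnitaryGroup (Fin 2) ℂ) → Edge d L → Fin d → Fin 2 → ℝ)
    (hρm : ∀ e ν s, Measurable fun V : GaugeConfig d L (Matrix.specialUnitaryGroup (Fin 2) ℂ) => ρ V e ν s)
    (hρloc : ∀ V W : GaugeConfig d L (Matrix.specialUnitaryGroup (Fin 2) ℂ),
      (∀ j : Edge d L, ¬(j.2 = μ ∧ χ j.1 = b) → V j = W j) →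
        ∀ e : Edge d L, (e.2 = μ ∧ χ e.1 = b) → ∀ ν s, ρ V e ν s = ρ W e ν s)
    (hκ : ∀ (V : GaugeConfig d L (Matrix.specialUnitaryGroup (Fin 2) ℂ)) (e : Edge d L), (e.2 = μ ∧ χ e.1 = b) →
      |c| * ∑ ν ∈ Finset.univ.erase e.2, (|ρ V e ν 0| + |ρ V e ν 1|) < 1)
    {S : GaugeConfig d L (Matrix.specialUnitaryGroup (Fin 2) ℂ) → ℝ} (hS : Measurable S) (c' : ℝ)
    {g : GaugeConfig d L (Matrix.specialUnitaryGroup (Fin 2) ℂ) → ((Edge d L × Fin 3) → ℝ)} (hg : Measurable g) (n : ℕ) :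
    ∃ F : GaugeConfig d L (Matrix.specialUnitaryGroup (Fin 2) ℂ) ≃ᵐ GaugeConfig d L (Matrix.specialUnitaryGroup (Fin 2) ℂ),
      (⇑F = fun (V : GaugeConfig d L (Matrix.specialUnitaryGroup (Fin 2) ℂ)) (e : Edge d L) =>
        if e.2 = μ ∧ χ e.1 = b then
          gaussUnit (geodesicKick c (∑ ν ∈ Finset.univ.erase e.2,
            (ρ V e ν 0 • vecQuat (((V (Site.shift e.1 e.2, ν) * (V (Site.shift e.1 ν, e.2))⁻¹ * (V (e.1, ν))⁻¹)⁻¹ : Matrix.specialUnitaryGroup (Fin 2) ℂ) : Matrix (Fin 2) (Fin 2) ℂ) +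
              ρ V e ν 1 • vecQuat ((((V (Site.shift (e.1 - Pi.single ν 1) e.2, ν))⁻¹ * (V (e.1 - Pi.single ν 1, e.2))⁻¹ * V (e.1 - Pi.single ν 1, ν))⁻¹ : Matrix.specialUnitaryGroup (Fin 2) ℂ) : Matrix (Fin 2) (Fin 2) ℂ)))
            (vecQuat ((V e : Matrix.specialUnitaryGroup (Fin 2) ℂ) : Matrix (Fin 2) (Fin 2) ℂ)))
        else V e) ∧
      IsReversible
        (conjKernel
          (refreshUpdate
            (involMH
              (⇑((flip : Equiv.Perm (GaugeConfig d L (Matrix.specialUnitaryGroup (Fin 2) ℂ) × ((Edge d L × Fin 3) → ℝ))) *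
                  leapfrog (mulDrift fun q : (Edge d L × Fin 3) → ℝ =>
                    fun ℓ : Edge d L => gaussUnit (toLp 2
          ![Real.cos (c' * Real.sqrt (q (ℓ, 0) ^ 2 + q (ℓ, 1) ^ 2 + q (ℓ, 2) ^ 2)),
            c' * Real.sinc (c' * Real.sqrt (q (ℓ, 0) ^ 2 + q (ℓ, 1) ^ 2 + q (ℓ, 2) ^ 2)) * q (ℓ, 0),
            c' * Real.sinc (c' * Real.sqrt (q (ℓ, 0) ^ 2 + q (ℓ, 1) ^ 2 + q (ℓ, 2) ^ 2)) * q (ℓ, 1),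
            c' * Real.sinc (c' * Real.sqrt (q (ℓ, 0) ^ 2 + q (ℓ, 1) ^ 2 + q (ℓ, 2) ^ 2)) * q (ℓ, 2)])) g ^ n))
              (measurable_flip_leapfrog_pow (measurable_mulDrift (measurable_su2Drift c')) hg n)
              fun z : GaugeConfig d L (Matrix.specialUnitaryGroup (Fin 2) ℂ) × ((Edge d L × Fin 3) → ℝ) =>
                (S (F z.1) - Real.log (∏ a : {e : Edge d L // e.2 = μ ∧ χ e.1 = b},
          (if Real.sin (angle (∑ ν ∈ Finset.univ.erase a.1.2,
            (ρ z.1 a.1 ν 0 • vecQuat (((z.1 (Site.shift a.1.1 a.1.2, ν) * (z.1 (Site.shift a.1.1 ν, a.1.2))⁻¹ * (z.1 (a.1.1, ν))⁻¹)⁻¹ : Matrix.specialUnitaryGroup (Fin 2) ℂ) : Matrix (Fin 2) (Fin 2) ℂ) +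
              ρ z.1 a.1 ν 1 • vecQuat ((((z.1 (Site.shift (a.1.1 - Pi.single ν 1) a.1.2, ν))⁻¹ * (z.1 (a.1.1 - Pi.single ν 1, a.1.2))⁻¹ * z.1 (a.1.1 - Pi.single ν 1, ν))⁻¹ : Matrix.specialUnitaryGroup (Fin 2) ℂ) : Matrix (Fin 2) (Fin 2) ℂ))) (vecQuat ((z.1 a.1 : Matrix.specialUnitaryGroup (Fin 2) ℂ) : Matrix (Fin 2) (Fin 2) ℂ))) = 0 then
            (1 - c * ‖(∑ ν ∈ Finset.univ.erase a.1.2,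
            (ρ z.1 a.1 ν 0 • vecQuat (((z.1 (Site.shift a.1.1 a.1.2, ν) * (z.1 (Site.shift a.1.1 ν, a.1.2))⁻¹ * (z.1 (a.1.1, ν))⁻¹)⁻¹ : Matrix.specialUnitaryGroup (Fin 2) ℂ) : Matrix (Fin 2) (Fin 2) ℂ) +
              ρ z.1 a.1 ν 1 • vecQuat ((((z.1 (Site.shift (a.1.1 - Pi.single ν 1) a.1.2, ν))⁻¹ * (z.1 (a.1.1 - Pi.single ν 1, a.1.2))⁻¹ * z.1 (a.1.1 - Pi.single ν 1, ν))⁻¹ : Matrix.specialUnitaryGroup (Fin 2) ℂ) : Matrix (Fin 2) (Fin 2) ℂ)))‖ * Real.cos (angle (∑ ν ∈ Finset.univ.erase a.1.2,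
            (ρ z.1 a.1 ν 0 • vecQuat (((z.1 (Site.shift a.1.1 a.1.2, ν) * (z.1 (Site.shift a.1.1 ν, a.1.2))⁻¹ * (z.1 (a.1.1, ν))⁻¹)⁻¹ : Matrix.specialUnitaryGroup (Fin 2) ℂ) : Matrix (Fin 2) (Fin 2) ℂ) +
              ρ z.1 a.1 ν 1 • vecQuat ((((z.1 (Site.shift (a.1.1 - Pi.single ν 1) a.1.2, ν))⁻¹ * (z.1 (a.1.1 - Pi.single ν 1, a.1.2))⁻¹ * z.1 (a.1.1 - Pi.single ν 1, ν))⁻¹ : Matrix.specialUnitaryGroup (Fin 2) ℂ) : Matrix (Fin 2) (Fin 2) ℂ))) (vecQuat ((z.1 a.1 : Matrix.specialUnitaryGroup (Fin 2) ℂ) : Matrix (Fin 2) (Fin 2) ℂ)))) ^ 3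
          else kickJac (c * ‖(∑ ν ∈ Finset.univ.erase a.1.2,
            (ρ z.1 a.1 ν 0 • vecQuat (((z.1 (Site.shift a.1.1 a.1.2, ν) * (z.1 (Site.shift a.1.1 ν, a.1.2))⁻¹ * (z.1 (a.1.1, ν))⁻¹)⁻¹ : Matrix.specialUnitaryGroup (Fin 2) ℂ) : Matrix (Fin 2) (Fin 2) ℂ) +
              ρ z.1 a.1 ν 1 • vecQuat ((((z.1 (Site.shift (a.1.1 - Pi.single ν 1) a.1.2, ν))⁻¹ * (z.1 (a.1.1 - Pi.single ν 1, a.1.2))⁻¹ * z.1 (a.1.1 - Pi.single ν 1, ν))⁻¹ : Matrix.specialUnitaryGroup (Fin 2) ℂ) : Matrix (Fin 2) (Fin 2) ℂ)))‖) 2 (angle (∑ ν ∈ Finset.univ.erase a.1.2,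
            (ρ z.1 a.1 ν 0 • vecQuat (((z.1 (Site.shift a.1.1 a.1.2, ν) * (z.1 (Site.shift a.1.1 ν, a.1.2))⁻¹ * (z.1 (a.1.1, ν))⁻¹)⁻¹ : Matrix.specialUnitaryGroup (Fin 2) ℂ) : Matrix (Fin 2) (Fin 2) ℂ) +
              ρ z.1 a.1 ν 1 • vecQuat ((((z.1 (Site.shift (a.1.1 - Pi.single ν 1) a.1.2, ν))⁻¹ * (z.1 (a.1.1 - Pi.single ν 1, a.1.2))⁻¹ * z.1 (a.1.1 - Pi.single ν 1, ν))⁻¹ : Matrix.specialUnitaryGroup (Fin 2) ℂ) : Matrix (Fin 2) (Fin 2) ℂ))) (vecQuat ((z.1 a.1 : Matrix.specialUnitaryGroup (Fin 2) ℂ) : Matrix (Fin 2) (Fin 2) ℂ)))))) + ∑ i, z.2 i ^ 2 / 2)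
            ((((volume : Measure ((Edge d L × Fin 3) → ℝ)).withDensity
                  fun q => ENNReal.ofReal (Real.exp (-(∑ i, q i ^ 2 / 2)))) Set.univ)⁻¹ •
              (volume : Measure ((Edge d L × Fin 3) → ℝ)).withDensity
                fun q => ENNReal.ofReal (Real.exp (-(∑ i, q i ^ 2 / 2)))))
          F)
        ((Measure.pi fun _ : Edge d L => haarProbability (Matrix.specialUnitaryGroup (Fin 2) ℂ)).withDensity
          fun U => ENNReal.ofReal (Real.exp (-S U))) := by
  obtain ⟨F, hF, hJ, hpos, hJm'⟩ :=
    exists_measurableEquiv_su2ResidualLayer χ hχ μ b ρ hρm hρloc hκ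
  haveI := isNegInvariant_volume_pi (Λ := Edge d L × Fin 3)
  refine ⟨F, hF, ?_⟩
  exact gauge_fthmc_leapfrog_config_isReversible
    (μ := Measure.pi fun _ : Edge d L => haarProbability (Matrix.specialUnitaryGroup (Fin 2) ℂ))
    (ν := (volume : Measure ((Edge d L × Fin 3) → ℝ))) (F := F)
    (e := fun q : (Edge d L × Fin 3) → ℝ =>
                    fun ℓ : Edge d L => gaussUnit (toLp 2
          ![Real.cos (c' * Real.sqrt (q (ℓ, 0) ^ 2 + q (ℓ, 1) ^ 2 + q (ℓ, 2) ^ 2)),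
            c' * Real.sinc (c' * Real.sqrt (q (ℓ, 0) ^ 2 + q (ℓ, 1) ^ 2 + q (ℓ, 2) ^ 2)) * q (ℓ, 0),
            c' * Real.sinc (c' * Real.sqrt (q (ℓ, 0) ^ 2 + q (ℓ, 1) ^ 2 + q (ℓ, 2) ^ 2)) * q (ℓ, 1),
            c' * Real.sinc (c' * Real.sqrt (q (ℓ, 0) ^ 2 + q (ℓ, 1) ^ 2 + q (ℓ, 2) ^ 2)) * q (ℓ, 2)]))
    (g := g) (S := S) (T := fun q : (Edge d L × Fin 3) → ℝ => ∑ i, q i ^ 2 / 2)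
    hpos hJm' hJ (fun q => su2Drift_neg c' q) (measurable_su2Drift c') hg n hS
    measurable_piGaussianKinetic


/-- **FT-HMC through one learned `SU(2)` residual layer, started in equilibrium, has
`⟨e^{−ΔH̃}⟩ = 1` exactly** (Creutz's identity through the certified layer). -/
theorem su2_fthmc_leapfrog_gaussian_creutz_residualLayer
    (hχ : ∀ (x : Site d L) (i : Fin d), χ (x.shift i) ≠ χ x) (μ : Fin d) (b : X) {c : ℝ}
    (ρ : GaugeConfig d L (Matrix.specialUnitaryGroup (Fin 2) ℂ) → Edge d L → Fin d → Fin 2 → ℝ)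
    (hρm : ∀ e ν s, Measurable fun V : GaugeConfig d L (Matrix.specialUnitaryGroup (Fin 2) ℂ) => ρ V e ν s)
    (hρloc : ∀ V W : GaugeConfig d L (Matrix.specialUnitaryGroup (Fin 2) ℂ),
      (∀ j : Edge d L, ¬(j.2 = μ ∧ χ j.1 = b) → V j = W j) →
        ∀ e : Edge d L, (e.2 = μ ∧ χ e.1 = b) → ∀ ν s, ρ V e ν s = ρ W e ν s)
    (hκ : ∀ (V : GaugeConfig d L (Matrix.specialUnitaryGroup (Fin 2) ℂ)) (e : Edge d L), (e.2 = μ ∧ χ e.1 = b) →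
      |c| * ∑ ν ∈ Finset.univ.erase e.2, (|ρ V e ν 0| + |ρ V e ν 1|) < 1)
    {S : GaugeConfig d L (Matrix.specialUnitaryGroup (Fin 2) ℂ) → ℝ} (hS : Measurable S)
    (hSi : Integrable (fun V => Real.exp (-S V))
      (Measure.pi fun _ : Edge d L => haarProbability (Matrix.specialUnitaryGroup (Fin 2) ℂ)))
    (c' : ℝ) {g : GaugeConfig d L (Matrix.specialUnitaryGroup (Fin 2) ℂ) → ((Edge d L × Fin 3) → ℝ)} (hg : Measurable g) (n : ℕ) :
    ∃ F : GaugeConfig d L (Matrix.specialUnitaryGroup (Fin 2) ℂ) ≃ᵐ GaugeConfig d L (Matrix.specialUnitaryGroup (Fin 2) ℂ),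
      (⇑F = fun (V : GaugeConfig d L (Matrix.specialUnitaryGroup (Fin 2) ℂ)) (e : Edge d L) =>
        if e.2 = μ ∧ χ e.1 = b then
          gaussUnit (geodesicKick c (∑ ν ∈ Finset.univ.erase e.2,
            (ρ V e ν 0 • vecQuat (((V (Site.shift e.1 e.2, ν) * (V (Site.shift e.1 ν, e.2))⁻¹ * (V (e.1, ν))⁻¹)⁻¹ : Matrix.specialUnitaryGroup (Fin 2) ℂ) : Matrix (Fin 2) (Fin 2) ℂ) +
              ρ V e ν 1 • vecQuat ((((V (Site.shift (e.1 - Pi.single ν 1) e.2, ν))⁻¹ * (V (e.1 - Pi.single ν 1, e.2))⁻¹ * V (e.1 - Pi.single ν 1, ν))⁻¹ : Matrix.specialUnitaryGroup (Fin 2) ℂ) : Matrix (Fin 2) (Fin 2) ℂ)))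
            (vecQuat ((V e : Matrix.specialUnitaryGroup (Fin 2) ℂ) : Matrix (Fin 2) (Fin 2) ℂ)))
        else V e) ∧
      ∫ z, Real.exp (-(((S (F ((((flip : Equiv.Perm (GaugeConfig d L (Matrix.specialUnitaryGroup (Fin 2) ℂ) × ((Edge d L × Fin 3) → ℝ))) *
              leapfrog (mulDrift (fun q : (Edge d L × Fin 3) → ℝ =>
                    fun ℓ : Edge d L => gaussUnit (toLp 2
          ![Real.cos (c' * Real.sqrt (q (ℓ, 0) ^ 2 + q (ℓ, 1) ^ 2 + q (ℓ, 2) ^ 2)),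
            c' * Real.sinc (c' * Real.sqrt (q (ℓ, 0) ^ 2 + q (ℓ, 1) ^ 2 + q (ℓ, 2) ^ 2)) * q (ℓ, 0),
            c' * Real.sinc (c' * Real.sqrt (q (ℓ, 0) ^ 2 + q (ℓ, 1) ^ 2 + q (ℓ, 2) ^ 2)) * q (ℓ, 1),
            c' * Real.sinc (c' * Real.sqrt (q (ℓ, 0) ^ 2 + q (ℓ, 1) ^ 2 + q (ℓ, 2) ^ 2)) * q (ℓ, 2)]))) g ^ n)) z).1) -
            Real.log ((fun V : GaugeConfig d L (Matrix.specialUnitaryGroup (Fin 2) ℂ) => ∏ a : {e : Edge d L // e.2 = μ ∧ χ e.1 = b},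
          (if Real.sin (angle (∑ ν ∈ Finset.univ.erase a.1.2,
            (ρ V a.1 ν 0 • vecQuat (((V (Site.shift a.1.1 a.1.2, ν) * (V (Site.shift a.1.1 ν, a.1.2))⁻¹ * (V (a.1.1, ν))⁻¹)⁻¹ : Matrix.specialUnitaryGroup (Fin 2) ℂ) : Matrix (Fin 2) (Fin 2) ℂ) +
              ρ V a.1 ν 1 • vecQuat ((((V (Site.shift (a.1.1 - Pi.single ν 1) a.1.2, ν))⁻¹ * (V (a.1.1 - Pi.single ν 1, a.1.2))⁻¹ * V (a.1.1 - Pi.single ν 1, ν))⁻¹ : Matrix.specialUnitaryGroup (Fin 2) ℂ) : Matrix (Fin 2) (Fin 2) ℂ))) (vecQuat ((V a.1 : Matrix.specialUnitaryGroup (Fin 2) ℂ) : Matrix (Fin 2) (Fin 2) ℂ))) = 0 then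
            (1 - c * ‖(∑ ν ∈ Finset.univ.erase a.1.2,
            (ρ V a.1 ν 0 • vecQuat (((V (Site.shift a.1.1 a.1.2, ν) * (V (Site.shift a.1.1 ν, a.1.2))⁻¹ * (V (a.1.1, ν))⁻¹)⁻¹ : Matrix.specialUnitaryGroup (Fin 2) ℂ) : Matrix (Fin 2) (Fin 2) ℂ) +
              ρ V a.1 ν 1 • vecQuat ((((V (Site.shift (a.1.1 - Pi.single ν 1) a.1.2, ν))⁻¹ * (V (a.1.1 - Pi.single ν 1, a.1.2))⁻¹ * V (a.1.1 - Pi.single ν 1, ν))⁻¹ : Matrix.specialUnitaryGroup (Fin 2) ℂ) : Matrix (Fin 2) (Fin 2) ℂ)))‖ * Real.cos (angle (∑ ν ∈ Finset.univ.erase a.1.2,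
            (ρ V a.1 ν 0 • vecQuat (((V (Site.shift a.1.1 a.1.2, ν) * (V (Site.shift a.1.1 ν, a.1.2))⁻¹ * (V (a.1.1, ν))⁻¹)⁻¹ : Matrix.specialUnitaryGroup (Fin 2) ℂ) : Matrix (Fin 2) (Fin 2) ℂ) +
              ρ V a.1 ν 1 • vecQuat ((((V (Site.shift (a.1.1 - Pi.single ν 1) a.1.2, ν))⁻¹ * (V (a.1.1 - Pi.single ν 1, a.1.2))⁻¹ * V (a.1.1 - Pi.single ν 1, ν))⁻¹ : Matrix.specialUnitaryGroup (Fin 2) ℂ) : Matrix (Fin 2) (Fin 2) ℂ))) (vecQuat ((V a.1 : Matrix.specialUnitaryGroup (Fin 2) ℂ) : Matrix (Fin 2) (Fin 2) ℂ)))) ^ 3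
          else kickJac (c * ‖(∑ ν ∈ Finset.univ.erase a.1.2,
            (ρ V a.1 ν 0 • vecQuat (((V (Site.shift a.1.1 a.1.2, ν) * (V (Site.shift a.1.1 ν, a.1.2))⁻¹ * (V (a.1.1, ν))⁻¹)⁻¹ : Matrix.specialUnitaryGroup (Fin 2) ℂ) : Matrix (Fin 2) (Fin 2) ℂ) +
              ρ V a.1 ν 1 • vecQuat ((((V (Site.shift (a.1.1 - Pi.single ν 1) a.1.2, ν))⁻¹ * (V (a.1.1 - Pi.single ν 1, a.1.2))⁻¹ * V (a.1.1 - Pi.single ν 1, ν))⁻¹ : Matrix.specialUnitaryGroup (Fin 2) ℂ) : Matrix (Fin 2) (Fin 2) ℂ)))‖) 2 (angle (∑ ν ∈ Finset.univ.erase a.1.2,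
            (ρ V a.1 ν 0 • vecQuat (((V (Site.shift a.1.1 a.1.2, ν) * (V (Site.shift a.1.1 ν, a.1.2))⁻¹ * (V (a.1.1, ν))⁻¹)⁻¹ : Matrix.specialUnitaryGroup (Fin 2) ℂ) : Matrix (Fin 2) (Fin 2) ℂ) +
              ρ V a.1 ν 1 • vecQuat ((((V (Site.shift (a.1.1 - Pi.single ν 1) a.1.2, ν))⁻¹ * (V (a.1.1 - Pi.single ν 1, a.1.2))⁻¹ * V (a.1.1 - Pi.single ν 1, ν))⁻¹ : Matrix.specialUnitaryGroup (Fin 2) ℂ) : Matrix (Fin 2) (Fin 2) ℂ))) (vecQuat ((V a.1 : Matrix.specialUnitaryGroup (Fin 2) ℂ) : Matrix (Fin 2) (Fin 2) ℂ)))))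
              ((((flip : Equiv.Perm (GaugeConfig d L (Matrix.specialUnitaryGroup (Fin 2) ℂ) × ((Edge d L × Fin 3) → ℝ))) *
              leapfrog (mulDrift (fun q : (Edge d L × Fin 3) → ℝ =>
                    fun ℓ : Edge d L => gaussUnit (toLp 2
          ![Real.cos (c' * Real.sqrt (q (ℓ, 0) ^ 2 + q (ℓ, 1) ^ 2 + q (ℓ, 2) ^ 2)),
            c' * Real.sinc (c' * Real.sqrt (q (ℓ, 0) ^ 2 + q (ℓ, 1) ^ 2 + q (ℓ, 2) ^ 2)) * q (ℓ, 0),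
            c' * Real.sinc (c' * Real.sqrt (q (ℓ, 0) ^ 2 + q (ℓ, 1) ^ 2 + q (ℓ, 2) ^ 2)) * q (ℓ, 1),
            c' * Real.sinc (c' * Real.sqrt (q (ℓ, 0) ^ 2 + q (ℓ, 1) ^ 2 + q (ℓ, 2) ^ 2)) * q (ℓ, 2)]))) g ^ n)) z).1)) +
            ∑ i, ((((flip : Equiv.Perm (GaugeConfig d L (Matrix.specialUnitaryGroup (Fin 2) ℂ) × ((Edge d L × Fin 3) → ℝ))) *
              leapfrog (mulDrift (fun q : (Edge d L × Fin 3) → ℝ =>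
                    fun ℓ : Edge d L => gaussUnit (toLp 2
          ![Real.cos (c' * Real.sqrt (q (ℓ, 0) ^ 2 + q (ℓ, 1) ^ 2 + q (ℓ, 2) ^ 2)),
            c' * Real.sinc (c' * Real.sqrt (q (ℓ, 0) ^ 2 + q (ℓ, 1) ^ 2 + q (ℓ, 2) ^ 2)) * q (ℓ, 0),
            c' * Real.sinc (c' * Real.sqrt (q (ℓ, 0) ^ 2 + q (ℓ, 1) ^ 2 + q (ℓ, 2) ^ 2)) * q (ℓ, 1),
            c' * Real.sinc (c' * Real.sqrt (q (ℓ, 0) ^ 2 + q (ℓ, 1) ^ 2 + q (ℓ, 2) ^ 2)) * q (ℓ, 2)]))) g ^ n)) z).2 i ^ 2 / 2) -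
          ((S (F z.1) - Real.log ((fun V : GaugeConfig d L (Matrix.specialUnitaryGroup (Fin 2) ℂ) => ∏ a : {e : Edge d L // e.2 = μ ∧ χ e.1 = b},
          (if Real.sin (angle (∑ ν ∈ Finset.univ.erase a.1.2,
            (ρ V a.1 ν 0 • vecQuat (((V (Site.shift a.1.1 a.1.2, ν) * (V (Site.shift a.1.1 ν, a.1.2))⁻¹ * (V (a.1.1, ν))⁻¹)⁻¹ : Matrix.specialUnitaryGroup (Fin 2) ℂ) : Matrix (Fin 2) (Fin 2) ℂ) +
              ρ V a.1 ν 1 • vecQuat ((((V (Site.shift (a.1.1 - Pi.single ν 1) a.1.2, ν))⁻¹ * (V (a.1.1 - Pi.single ν 1, a.1.2))⁻¹ * V (a.1.1 - Pi.single ν 1, ν))⁻¹ : Matrix.specialUnitaryGroup (Fin 2) ℂ) : Matrix (Fin 2) (Fin 2) ℂ))) (vecQuat ((V a.1 : Matrix.specialUnitaryGroup (Fin 2) ℂ) : Matrix (Fin 2) (Fin 2) ℂ))) = 0 then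
            (1 - c * ‖(∑ ν ∈ Finset.univ.erase a.1.2,
            (ρ V a.1 ν 0 • vecQuat (((V (Site.shift a.1.1 a.1.2, ν) * (V (Site.shift a.1.1 ν, a.1.2))⁻¹ * (V (a.1.1, ν))⁻¹)⁻¹ : Matrix.specialUnitaryGroup (Fin 2) ℂ) : Matrix (Fin 2) (Fin 2) ℂ) +
              ρ V a.1 ν 1 • vecQuat ((((V (Site.shift (a.1.1 - Pi.single ν 1) a.1.2, ν))⁻¹ * (V (a.1.1 - Pi.single ν 1, a.1.2))⁻¹ * V (a.1.1 - Pi.single ν 1, ν))⁻¹ : Matrix.specialUnitaryGroup (Fin 2) ℂ) : Matrix (Fin 2) (Fin 2) ℂ)))‖ * Real.cos (angle (∑ ν ∈ Finset.univ.erase a.1.2,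
            (ρ V a.1 ν 0 • vecQuat (((V (Site.shift a.1.1 a.1.2, ν) * (V (Site.shift a.1.1 ν, a.1.2))⁻¹ * (V (a.1.1, ν))⁻¹)⁻¹ : Matrix.specialUnitaryGroup (Fin 2) ℂ) : Matrix (Fin 2) (Fin 2) ℂ) +
              ρ V a.1 ν 1 • vecQuat ((((V (Site.shift (a.1.1 - Pi.single ν 1) a.1.2, ν))⁻¹ * (V (a.1.1 - Pi.single ν 1, a.1.2))⁻¹ * V (a.1.1 - Pi.single ν 1, ν))⁻¹ : Matrix.specialUnitaryGroup (Fin 2) ℂ) : Matrix (Fin 2) (Fin 2) ℂ))) (vecQuat ((V a.1 : Matrix.specialUnitaryGroup (Fin 2) ℂ) : Matrix (Fin 2) (Fin 2) ℂ)))) ^ 3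
          else kickJac (c * ‖(∑ ν ∈ Finset.univ.erase a.1.2,
            (ρ V a.1 ν 0 • vecQuat (((V (Site.shift a.1.1 a.1.2, ν) * (V (Site.shift a.1.1 ν, a.1.2))⁻¹ * (V (a.1.1, ν))⁻¹)⁻¹ : Matrix.specialUnitaryGroup (Fin 2) ℂ) : Matrix (Fin 2) (Fin 2) ℂ) +
              ρ V a.1 ν 1 • vecQuat ((((V (Site.shift (a.1.1 - Pi.single ν 1) a.1.2, ν))⁻¹ * (V (a.1.1 - Pi.single ν 1, a.1.2))⁻¹ * V (a.1.1 - Pi.single ν 1, ν))⁻¹ : Matrix.specialUnitaryGroup (Fin 2) ℂ) : Matrix (Fin 2) (Fin 2) ℂ)))‖) 2 (angle (∑ ν ∈ Finset.univ.erase a.1.2,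
            (ρ V a.1 ν 0 • vecQuat (((V (Site.shift a.1.1 a.1.2, ν) * (V (Site.shift a.1.1 ν, a.1.2))⁻¹ * (V (a.1.1, ν))⁻¹)⁻¹ : Matrix.specialUnitaryGroup (Fin 2) ℂ) : Matrix (Fin 2) (Fin 2) ℂ) +
              ρ V a.1 ν 1 • vecQuat ((((V (Site.shift (a.1.1 - Pi.single ν 1) a.1.2, ν))⁻¹ * (V (a.1.1 - Pi.single ν 1, a.1.2))⁻¹ * V (a.1.1 - Pi.single ν 1, ν))⁻¹ : Matrix.specialUnitaryGroup (Fin 2) ℂ) : Matrix (Fin 2) (Fin 2) ℂ))) (vecQuat ((V a.1 : Matrix.specialUnitaryGroup (Fin 2) ℂ) : Matrix (Fin 2) (Fin 2) ℂ)))))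
              z.1)) + ∑ i, z.2 i ^ 2 / 2)))
      ∂(boltzmann ((Measure.pi fun _ : Edge d L => haarProbability (Matrix.specialUnitaryGroup (Fin 2) ℂ)).prod
            (volume : Measure ((Edge d L × Fin 3) → ℝ)))
          fun z : GaugeConfig d L (Matrix.specialUnitaryGroup (Fin 2) ℂ) × ((Edge d L × Fin 3) → ℝ) =>
            (S (F z.1) - Real.log ((fun V : GaugeConfig d L (Matrix.specialUnitaryGroup (Fin 2) ℂ) => ∏ a : {e : Edge d L // e.2 = μ ∧ χ e.1 = b},
          (if Real.sin (angle (∑ ν ∈ Finset.univ.erase a.1.2,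
            (ρ V a.1 ν 0 • vecQuat (((V (Site.shift a.1.1 a.1.2, ν) * (V (Site.shift a.1.1 ν, a.1.2))⁻¹ * (V (a.1.1, ν))⁻¹)⁻¹ : Matrix.specialUnitaryGroup (Fin 2) ℂ) : Matrix (Fin 2) (Fin 2) ℂ) +
              ρ V a.1 ν 1 • vecQuat ((((V (Site.shift (a.1.1 - Pi.single ν 1) a.1.2, ν))⁻¹ * (V (a.1.1 - Pi.single ν 1, a.1.2))⁻¹ * V (a.1.1 - Pi.single ν 1, ν))⁻¹ : Matrix.specialUnitaryGroup (Fin 2) ℂ) : Matrix (Fin 2) (Fin 2) ℂ))) (vecQuat ((V a.1 : Matrix.specialUnitaryGroup (Fin 2) ℂ) : Matrix (Fin 2) (Fin 2) ℂ))) = 0 then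
            (1 - c * ‖(∑ ν ∈ Finset.univ.erase a.1.2,
            (ρ V a.1 ν 0 • vecQuat (((V (Site.shift a.1.1 a.1.2, ν) * (V (Site.shift a.1.1 ν, a.1.2))⁻¹ * (V (a.1.1, ν))⁻¹)⁻¹ : Matrix.specialUnitaryGroup (Fin 2) ℂ) : Matrix (Fin 2) (Fin 2) ℂ) +
              ρ V a.1 ν 1 • vecQuat ((((V (Site.shift (a.1.1 - Pi.single ν 1) a.1.2, ν))⁻¹ * (V (a.1.1 - Pi.single ν 1, a.1.2))⁻¹ * V (a.1.1 - Pi.single ν 1, ν))⁻¹ : Matrix.specialUnitaryGroup (Fin 2) ℂ) : Matrix (Fin 2) (Fin 2) ℂ)))‖ * Real.cos (angle (∑ ν ∈ Finset.univ.erase a.1.2,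
            (ρ V a.1 ν 0 • vecQuat (((V (Site.shift a.1.1 a.1.2, ν) * (V (Site.shift a.1.1 ν, a.1.2))⁻¹ * (V (a.1.1, ν))⁻¹)⁻¹ : Matrix.specialUnitaryGroup (Fin 2) ℂ) : Matrix (Fin 2) (Fin 2) ℂ) +
              ρ V a.1 ν 1 • vecQuat ((((V (Site.shift (a.1.1 - Pi.single ν 1) a.1.2, ν))⁻¹ * (V (a.1.1 - Pi.single ν 1, a.1.2))⁻¹ * V (a.1.1 - Pi.single ν 1, ν))⁻¹ : Matrix.specialUnitaryGroup (Fin 2) ℂ) : Matrix (Fin 2) (Fin 2) ℂ))) (vecQuat ((V a.1 : Matrix.specialUnitaryGroup (Fin 2) ℂ) : Matrix (Fin 2) (Fin 2) ℂ)))) ^ 3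
          else kickJac (c * ‖(∑ ν ∈ Finset.univ.erase a.1.2,
            (ρ V a.1 ν 0 • vecQuat (((V (Site.shift a.1.1 a.1.2, ν) * (V (Site.shift a.1.1 ν, a.1.2))⁻¹ * (V (a.1.1, ν))⁻¹)⁻¹ : Matrix.specialUnitaryGroup (Fin 2) ℂ) : Matrix (Fin 2) (Fin 2) ℂ) +
              ρ V a.1 ν 1 • vecQuat ((((V (Site.shift (a.1.1 - Pi.single ν 1) a.1.2, ν))⁻¹ * (V (a.1.1 - Pi.single ν 1, a.1.2))⁻¹ * V (a.1.1 - Pi.single ν 1, ν))⁻¹ : Matrix.specialUnitaryGroup (Fin 2) ℂ) : Matrix (Fin 2) (Fin 2) ℂ)))‖) 2 (angle (∑ ν ∈ Finset.univ.erase a.1.2,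
            (ρ V a.1 ν 0 • vecQuat (((V (Site.shift a.1.1 a.1.2, ν) * (V (Site.shift a.1.1 ν, a.1.2))⁻¹ * (V (a.1.1, ν))⁻¹)⁻¹ : Matrix.specialUnitaryGroup (Fin 2) ℂ) : Matrix (Fin 2) (Fin 2) ℂ) +
              ρ V a.1 ν 1 • vecQuat ((((V (Site.shift (a.1.1 - Pi.single ν 1) a.1.2, ν))⁻¹ * (V (a.1.1 - Pi.single ν 1, a.1.2))⁻¹ * V (a.1.1 - Pi.single ν 1, ν))⁻¹ : Matrix.specialUnitaryGroup (Fin 2) ℂ) : Matrix (Fin 2) (Fin 2) ℂ))) (vecQuat ((V a.1 : Matrix.specialUnitaryGroup (Fin 2) ℂ) : Matrix (Fin 2) (Fin 2) ℂ)))))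
              z.1)) + ∑ i, z.2 i ^ 2 / 2) = 1 := by
  obtain ⟨F, hF, hJ, hpos, hJm'⟩ :=
    exists_measurableEquiv_su2ResidualLayer χ hχ μ b ρ hρm hρloc hκ
  exact ⟨F, hF, gauge_fthmc_leapfrog_gaussian_creutz hpos hJm' hJ (measurable_su2Drift c') hg n hS hSi⟩

end Layer

end Summit.Ventures.LatticeQCDFlow.Exactness
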